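import Summits.QuantumAdvantage.QuantumAdvantage.Theorems.WbwObfuscatedGluedTreesKowPhPrograms

/-!
# `WbwObfuscatedGluedTrees` (stmt-QuantumAdvantage-2340) — line `knowledge-of-walk-split`, STAGE 7 (the PRF hybrid):
# the query map of the layer-C program is polynomial time on codes (registered stub `stub_walkFPQ`)

The query map `walkQ Λ (n, req) as` of the adaptive straight-line program of layer C (`KowPhPrograms` §5) — the
next layer-B request `mkReq Λ n body = ⟨⟨1^μ, 1^d⟩, body⟩` after the answers `as` — is computed on the codes
`⟨⟨1ⁿ, req⟩, as⟩` (`pairE (pairE unE strE) (listE strE)`) by a polynomial-time string function, in the tree's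
`CodeFP` algebra, GIVEN the two schedules `1ⁿ ↦ 1^{μ(n)}`, `1ⁿ ↦ 1^{d(n)}` on codes (hypotheses):

* §1 the `match` of `walkQ` on the request is a cascade of tests on its first two bits, every branch being
  `mkReq Λ n` of a body (`wq_walkQ_eq`; the ill-formed requests fall into the bit-query branch, where `|q| = 0 ≠ 2N`);
* §2 bricks over computed arguments: `bitsOf w m` (as `fit w` of the binary numeral), the labels `mkLabel`, the
  fields `labDepth` / `labIdx`, the three permutation bodies `prpBodies` read at a computed index (`± 1 (mod 2^d)` on
  numerals, `2^d` from the unary `d`), the neighbour labels `nbrLabels` as a raw list;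
* §3 the bit-query branch (name length `N = μ + 2d + 3`, indexing the answer list and the label list by computed
  indices, the tests as computed bits) and the assembly (`CodeFP.ite` on the first two request bits, then the request
  code by two pairings).

[folklore] (closure of polynomial time under composition, AroraBarak2009 §1.3; objects: ChildsEtAl2003 §2 (labels,
the glued leaves) and §4 Game 1 (the request oracle)).
-/

set_option linter.dupNamespace false

noncomputable section

namespace Summit.QuantumAdvantage.QuantumAdvantage.Theorems.WbwObfuscatedGluedTrees.KnowledgeOfWalk.PrfHybrid

open Literature.Computability.Complexity Literature.Computability.QuantumComplexity
open Literature.Computability.QuantumComplexity.GluedTrees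
open Literature.Computability.Cryptography Literature.Computability.Cryptography.ObfuscatedGluedTrees
open Summit.QuantumAdvantage.QuantumAdvantage.Theorems.WbwObfuscatedGluedTrees.KnowledgeOfWalk.BlackBox
open Summit.QuantumAdvantage.QuantumAdvantage.Theorems.WbwObfuscatedGluedTrees.KnowledgeOfWalk.RealIdeal
open _root_.Computability
open Literature.Computability.Complexity.CodeFP (unE pairE strE listE natE bitE rawE fst snd const strTake strDrop
  strAppend strLength strVal strOfNat natOfUn unSucc unAdd unMulConst natPow natLt natEq natMod natAdd natSub natMul
  natDiv ulength natLength rawOfList rawGetD rawAppend rawCons rawSingleton strGetD consBit unE_injective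
  bitE_injective unLeNat)

/-! ## §1 The query map by tests -/

/-- **The query map by tests**: every branch of `walkQ` is a layer-B request `mkReq Λ n body`; the `match` on the
walker's request is the cascade "first bit or second bit set? (EXIT / ENTRANCE encryption) else the bit-query branch
at `q = req ⇂ 2`" (the fall-through requests `[]`, `[0]` land in the bit-query branch with `|q| = 0 ≠ 2N`).
[folklore] -/
private theorem wq_walkQ_eq (Λ : Params) (a : ℕ × List Bool) (as : List (List Bool)) :
    walkQ Λ a as = mkReq Λ a.1
      (if a.2.getD 0 false || a.2.getD 1 false then
        (if as.length = 0 then false :: false :: mkLabel (Λ.depth a.1) (a.2.getD 0 false) 0 0 else [])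
      else if (a.2.drop 2).length =
          nameLen (Λ.prfParam a.1) (Λ.depth a.1) + nameLen (Λ.prfParam a.1) (Λ.depth a.1) then
        (if as.length = 0 then false :: true :: (a.2.drop 2).take (nameLen (Λ.prfParam a.1) (Λ.depth a.1))
        else if ((as.getD 0 []).headD false) = false then []
        else if as.length ≤ 3 then
          (if labDepth (Λ.depth a.1) (as.getD 0 []).tail = Λ.depth a.1 then
            (prpBodies (Λ.depth a.1) ((as.getD 0 []).tail.headD false) (labIdx (Λ.depth a.1) (as.getD 0 []).tail)
              (as.getD 1 [])).getD (as.length - 1) []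
          else [])
        else if as.length - 4 <
            (nbrLabels (Λ.depth a.1) (as.getD 0 []).tail (as.getD 2 []) (as.getD 3 [])).length then
          false :: false :: (nbrLabels (Λ.depth a.1) (as.getD 0 []).tail (as.getD 2 []) (as.getD 3 [])).getD
            (as.length - 4) []
        else [])
      else []) := by
  obtain ⟨n, req⟩ := a
  have hN : ¬ (([] : List Bool).length =
      nameLen (Λ.prfParam n) (Λ.depth n) + nameLen (Λ.prfParam n) (Λ.depth n)) := by
    simp only [List.length_nil, nameLen, labelLen]; omega
  rcases req with _ | ⟨_ | _, _ | ⟨_ | _, q⟩⟩ <;>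
    simp only [walkQ, List.getD_nil, List.getD_cons_zero, List.getD_cons_succ, Bool.false_or, Bool.true_or,
      Bool.false_eq_true, if_false, if_true, List.drop_succ_cons, List.drop_zero, List.drop_nil, if_neg hN] <;>
    split_ifs <;> rfl

/-! ## §2 Bricks: digits, labels, the permutation bodies and the neighbour labels on codes -/

section Bricks

variable {α : Type} {eα : α → List Bool}

/-- The binary numeral of `m`, fitted to `w` bits, is `bitsOf w m` (adapted from toolkit `NbrBitFP`,
piece G3). [folklore] -/
private theorem wq_fit_natE (w m : ℕ) : fit w (natE m) = bitsOf w m := by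
  refine List.ext_getElem (by simp) fun t h₁ h₂ => ?_
  rw [length_bitsOf] at h₂
  have hb : (bitsOf w m)[t]'(by simpa using h₂) = m.testBit t := by simp [bitsOf]
  rw [hb]
  simp only [fit, List.getElem_take, List.getElem_append]
  split_ifs with h
  · have := Com.testBit_bitsToNat (natE m) t
    rw [CodeFP.bitsToNat_natE, List.getD_eq_getElem _ _ h] at this
    exact this.symm
  · rw [List.getElem_replicate]
    exact (Nat.testBit_lt_two_pow (Nat.size_le.1 (by rw [← CodeFP.length_natE]; omega))).symm

/-- `bitsOf w m` of a computed unary width `w` and a computed numeral `m` (`fit w` of the binary numeral).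
[cite: AroraBarak2009, §1.3] -/
private theorem wq_bitsOf {f g : α → ℕ} (hf : CodeFP eα unE f) (hg : CodeFP eα natE g) :
    CodeFP eα strE (fun a => bitsOf (f a) (g a)) :=
  (FPData.fitFP.comp (hf.pair (strOfNat.comp hg))).congr fun a => wq_fit_natE (f a) (g a)

/-- Assembling a label `mkLabel d s j i = s :: (bitsOf (d+1) j ++ bitsOf (d+1) i)` from computed fields.
[cite: ChildsEtAl2003, §2] -/
private theorem wq_mkLabel {fd fj fi : α → ℕ} {fs : α → Bool} (hd : CodeFP eα unE fd) (hs : CodeFP eα bitE fs)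
    (hj : CodeFP eα natE fj) (hi : CodeFP eα natE fi) :
    CodeFP eα strE (fun a => mkLabel (fd a) (fs a) (fj a) (fi a)) :=
  (consBit.comp (hs.pair (strAppend.comp ((wq_bitsOf (unSucc.comp hd) hj).pair
    (wq_bitsOf (unSucc.comp hd) hi))))).congr fun _ => rfl

/-- The depth field `labDepth d x` of a computed string, as a numeral. [folklore] -/
private theorem wq_labDepth {fd : α → ℕ} {fx : α → List Bool} (hd : CodeFP eα unE fd)
    (hx : CodeFP eα strE fx) : CodeFP eα natE (fun a => labDepth (fd a) (fx a)) :=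
  (strVal.comp (strTake.comp ((unSucc.comp hd).pair (strDrop.comp ((const eα 1).pair hx))))).congr fun _ => rfl

/-- The position field `labIdx d x` of a computed string, as a numeral. [folklore] -/
private theorem wq_labIdx {fd : α → ℕ} {fx : α → List Bool} (hd : CodeFP eα unE fd)
    (hx : CodeFP eα strE fx) : CodeFP eα natE (fun a => labIdx (fd a) (fx a)) :=
  (strVal.comp (strTake.comp ((unSucc.comp hd).pair
    (strDrop.comp ((unSucc.comp (unSucc.comp hd)).pair hx))))).congr fun _ => rfl

/-- The head bit of a computed string (`false` if empty). [folklore] -/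
private theorem wq_headD {fx : α → List Bool} (hx : CodeFP eα strE fx) :
    CodeFP eα bitE (fun a => (fx a).headD false) :=
  (strGetD.comp ((const eα 0).pair hx)).congr fun a => by cases fx a <;> rfl

/-- Three computed bits in front of a computed string. [folklore] -/
private theorem wq_cons3 (b₁ b₂ : Bool) {g : α → Bool} {f : α → List Bool} (hg : CodeFP eα bitE g)
    (hf : CodeFP eα strE f) : CodeFP eα strE (fun a => b₁ :: b₂ :: g a :: f a) :=
  consBit.comp ((const eα b₁).pair (consBit.comp ((const eα b₂).pair (consBit.comp (hg.pair hf)))))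

/-- **The permutation bodies by index**: item `k` of `prpBodies d s i p₁` — the inverse permutation of the leaf's
own side at `⟨i⟩_d` (`k = 0`), the forward permutation of the other table at `p₁` (`k = 1`) and at
`val p₁ ± 1 (mod 2^d)` (`k = 2`). [cite: ChildsEtAl2003, §2] -/
private theorem wq_prpBodies_getD (d : ℕ) (s : Bool) (i : ℕ) (p₁ : List Bool) (k : ℕ) :
    (prpBodies d s i p₁).getD k [] =
      if k = 0 then true :: true :: s :: bitsOf d i
      else if k = 1 then true :: false :: (!s) :: p₁
      else if k = 2 then true :: false :: (!s) :: bitsOf d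
        (if s then (bitsToNat p₁ + 1) % 2 ^ d else (bitsToNat p₁ + 2 ^ d - 1) % 2 ^ d)
      else [] := by
  unfold prpBodies
  rcases k with _ | _ | _ | k <;> cases s <;> simp

/-- Item `k` of the permutation bodies of computed `d`, `s`, `i`, `p₁`, `k`. [cite: AroraBarak2009, §1.3] -/
private theorem wq_prpBody {fd fi fk : α → ℕ} {fs : α → Bool} {fp : α → List Bool} (hd : CodeFP eα unE fd)
    (hs : CodeFP eα bitE fs) (hi : CodeFP eα natE fi) (hp : CodeFP eα strE fp) (hk : CodeFP eα unE fk) :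
    CodeFP eα strE (fun a => (prpBodies (fd a) (fs a) (fi a) (fp a)).getD (fk a) []) := by
  have hpow : CodeFP eα natE (fun a => 2 ^ fd a) := natPow.comp ((const eα 2).pair hd)
  have hv : CodeFP eα natE (fun a => bitsToNat (fp a)) := strVal.comp hp
  have hm : CodeFP eα natE (fun a => if fs a then (bitsToNat (fp a) + 1) % 2 ^ fd a
      else (bitsToNat (fp a) + 2 ^ fd a - 1) % 2 ^ fd a) :=
    hs.ite (natMod.comp ((natAdd.comp (hv.pair (const eα 1))).pair hpow))
      (natMod.comp ((natSub.comp ((natAdd.comp (hv.pair hpow)).pair (const eα 1))).pair hpow))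
  have ht : ∀ c : ℕ, CodeFP eα bitE (fun a => decide (fk a = c)) := fun c =>
    (CodeFP.eq unE_injective).comp (hk.pair (const eα c))
  refine (((ht 0).ite (wq_cons3 true true hs (wq_bitsOf hd hi)) ((ht 1).ite (wq_cons3 true false hs.not hp)
    ((ht 2).ite (wq_cons3 true false hs.not (wq_bitsOf hd hm)) (const eα ([] : List Bool)))))).congr fun a => ?_
  rw [wq_prpBodies_getD]
  simp only [decide_eq_true_eq]

/-- **The neighbour labels on codes**: `nbrLabels d x p₂ p₃` of computed arguments, as a raw list — the parent
(unless the depth field is `0`), then the two children or, at depth `d`, the two cross leaves read off `p₂`,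
`p₃`. [cite: ChildsEtAl2003, §2] -/
private theorem wq_nbrLabels {fd : α → ℕ} {fx f₂ f₃ : α → List Bool} (hd : CodeFP eα unE fd)
    (hx : CodeFP eα strE fx) (h₂ : CodeFP eα strE f₂) (h₃ : CodeFP eα strE f₃) :
    CodeFP eα (rawE strE) (fun a => nbrLabels (fd a) (fx a) (f₂ a) (f₃ a)) := by
  have hs := wq_headD hx
  have hj := wq_labDepth hd hx
  have hi := wq_labIdx hd hx
  have hdn : CodeFP eα natE (fun a => fd a) := natOfUn.comp hd
  have hP := wq_mkLabel hd hs (natSub.comp (hj.pair (const eα 1))) (natDiv.comp (hi.pair (const eα 2)))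
  have hC₀ := wq_mkLabel hd hs (natAdd.comp (hj.pair (const eα 1))) (natMul.comp ((const eα 2).pair hi))
  have hC₁ := wq_mkLabel hd hs (natAdd.comp (hj.pair (const eα 1)))
    (natAdd.comp ((natMul.comp ((const eα 2).pair hi)).pair (const eα 1)))
  have hX₂ := wq_mkLabel hd hs.not hdn (strVal.comp h₂)
  have hX₃ := wq_mkLabel hd hs.not hdn (strVal.comp h₃)
  refine ((rawAppend strE).comp (((natEq.comp (hj.pair (const eα 0))).ite (const eα ([] : List (List Bool)))
    ((rawSingleton strE).comp hP)).pair ((natEq.comp (hj.pair hdn)).ite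
      ((rawCons strE).comp (hX₂.pair ((rawSingleton strE).comp hX₃)))
      ((rawCons strE).comp (hC₀.pair ((rawSingleton strE).comp hC₁)))))).congr fun a => ?_
  simp only [nbrLabels, decide_eq_true_eq]

end Bricks

/-! ## §3 The bit-query branch and the assembly -/

section Assembly

variable {α : Type} {eα : α → List Bool}

/-- **The bit-query branch on codes** (`req = 0 0 q`): from computed `μ`, `d`, `q` and the raw answer list `as`,
the body of the next layer-B request — recognise `q ↾ N` (no answers yet), then, for a recognised leaf, the three
permutation bodies indexed by `|as| - 1`, then the encryptions of the neighbour labels indexed by `|as| - 4`; `[]`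
otherwise. Every test (`|q| = 2N`, `|as| = 0`, the recognition bit, `|as| ≤ 3`, depth field `= d`, index in
range) is a computed bit and the branch a cascade of `CodeFP.ite`. [cite: AroraBarak2009, §1.3] -/
private theorem wq_bodyC {fμ fd : α → ℕ} {fq : α → List Bool} {fas : α → List (List Bool)}
    (hμ : CodeFP eα unE fμ) (hd : CodeFP eα unE fd) (hq : CodeFP eα strE fq) (has : CodeFP eα (rawE strE) fas) :
    CodeFP eα strE (fun a =>
      if (fq a).length = nameLen (fμ a) (fd a) + nameLen (fμ a) (fd a) then
        (if (fas a).length = 0 then false :: true :: (fq a).take (nameLen (fμ a) (fd a))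
        else if (((fas a).getD 0 []).headD false) = false then []
        else if (fas a).length ≤ 3 then
          (if labDepth (fd a) ((fas a).getD 0 []).tail = fd a then
            (prpBodies (fd a) (((fas a).getD 0 []).tail.headD false) (labIdx (fd a) ((fas a).getD 0 []).tail)
              ((fas a).getD 1 [])).getD ((fas a).length - 1) []
          else [])
        else if (fas a).length - 4 <
            (nbrLabels (fd a) ((fas a).getD 0 []).tail ((fas a).getD 2 []) ((fas a).getD 3 [])).length then
          false :: false :: (nbrLabels (fd a) ((fas a).getD 0 []).tail ((fas a).getD 2 [])
            ((fas a).getD 3 [])).getD ((fas a).length - 4) []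
        else [])
      else []) := by
  have hN : CodeFP eα unE (fun a => nameLen (fμ a) (fd a)) :=
    (unAdd.comp (hμ.pair (unSucc.comp (unSucc.comp (unSucc.comp ((unMulConst 2).comp hd)))))).congr fun _ => rfl
  have hs : CodeFP eα unE (fun a => (fas a).length) := (ulength strE).comp has
  have hsn : CodeFP eα natE (fun a => (fas a).length) := (natLength strE).comp has
  have hg : ∀ k : ℕ, CodeFP eα strE (fun a => (fas a).getD k []) := fun k =>
    (rawGetD strE rfl).comp (has.pair (const eα k))
  have hx : CodeFP eα strE (fun a => ((fas a).getD 0 []).tail) :=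
    (strDrop.comp ((const eα 1).pair (hg 0))).congr fun _ => List.drop_one
  have hL := wq_nbrLabels hd hx (hg 2) (hg 3)
  have hk₄ : CodeFP eα natE (fun a => (fas a).length - 4) := natSub.comp (hsn.pair (const eα 4))
  have hB := wq_prpBody hd (wq_headD hx) (wq_labIdx hd hx) (hg 1) (MachineA.unSub.comp (hs.pair (const eα 1)))
  -- the tests
  have tq : CodeFP eα bitE (fun a => decide ((fq a).length = nameLen (fμ a) (fd a) + nameLen (fμ a) (fd a))) :=
    (CodeFP.eq unE_injective).comp ((strLength.comp hq).pair (unAdd.comp (hN.pair hN)))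
  have t₀ : CodeFP eα bitE (fun a => decide ((fas a).length = 0)) :=
    (CodeFP.eq unE_injective).comp (hs.pair (const eα 0))
  have th : CodeFP eα bitE (fun a => decide (((fas a).getD 0 []).headD false = false)) :=
    (CodeFP.eq bitE_injective).comp ((wq_headD (hg 0)).pair (const eα false))
  have t₃ : CodeFP eα bitE (fun a => decide ((fas a).length ≤ 3)) := unLeNat.comp (hs.pair (const eα 3))
  have td : CodeFP eα bitE (fun a => decide (labDepth (fd a) ((fas a).getD 0 []).tail = fd a)) :=
    natEq.comp ((wq_labDepth hd hx).pair (natOfUn.comp hd))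
  have tL : CodeFP eα bitE (fun a => decide ((fas a).length - 4 <
      (nbrLabels (fd a) ((fas a).getD 0 []).tail ((fas a).getD 2 []) ((fas a).getD 3 [])).length)) :=
    natLt.comp (hk₄.pair ((natLength strE).comp hL))
  have hnil : CodeFP eα strE (fun _ => ([] : List Bool)) := const _ _
  refine ((tq.ite (t₀.ite (consBit.comp ((const eα false).pair (consBit.comp ((const eα true).pair
      (strTake.comp (hN.pair hq))))))
    (th.ite hnil (t₃.ite (td.ite hB hnil) (tL.ite (consBit.comp ((const eα false).pair
      (consBit.comp ((const eα false).pair ((rawGetD strE rfl).comp (hL.pair hk₄)))))) hnil)))) hnil)).congr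
    fun a => ?_
  simp only [decide_eq_true_eq]

end Assembly

/-! ## The registered stub -/

/-- **Stub (layer C, the query map is polynomial time)**: the query map `walkQ Λ` of the layer-C program is
computed on the codes `⟨⟨1ⁿ, req⟩, as⟩` by a polynomial-time string function (`CodeFP`), given the two schedules
`1ⁿ ↦ 1^{μ(n)}`, `1ⁿ ↦ 1^{d(n)}` on codes: every ingredient — the request code `mkReq` (two pairings), the name
length `N = μ + 2d + 3`, the labels `mkLabel` (fitted binary numerals), the fields `labDepth` / `labIdx`, the
permutation bodies with `± 1 (mod 2^d)`, the neighbour labels, indexing the answer list by a computed index — is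
a typed combinator of the tree's `CodeFP` algebra, and the `match` on the request is a cascade of `CodeFP.ite` on its
first two bits (`wq_walkQ_eq`). [cite: AroraBarak2009, §1.3 (closure of polynomial time under composition)] -/
theorem stub_walkFPQ :
    ∀ (Λ : Params), CodeFP unE unE Λ.prfParam → CodeFP unE unE Λ.depth →
      CodeFP (pairE (pairE unE strE) (listE strE)) strE
        (fun p : (ℕ × List Bool) × List (List Bool) => walkQ Λ p.1 p.2) := by
  intro Λ hμΛ hdΛ
  have pn : CodeFP (pairE (pairE unE strE) (listE strE)) unE (fun p => p.1.1) := (fst _ _).fst'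
  have pr : CodeFP (pairE (pairE unE strE) (listE strE)) strE (fun p => p.1.2) := (fst _ _).snd'
  have pas : CodeFP (pairE (pairE unE strE) (listE strE)) (rawE strE) (fun p => p.2) :=
    (rawOfList strE).comp (snd _ _)
  have hμ : CodeFP (pairE (pairE unE strE) (listE strE)) unE (fun p => Λ.prfParam p.1.1) := hμΛ.comp pn
  have hd : CodeFP (pairE (pairE unE strE) (listE strE)) unE (fun p => Λ.depth p.1.1) := hdΛ.comp pn
  have hb₀ : CodeFP (pairE (pairE unE strE) (listE strE)) bitE (fun p => p.1.2.getD 0 false) :=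
    strGetD.comp ((const _ 0).pair pr)
  have hb₁ : CodeFP (pairE (pairE unE strE) (listE strE)) bitE (fun p => p.1.2.getD 1 false) :=
    strGetD.comp ((const _ 1).pair pr)
  have t₀ : CodeFP (pairE (pairE unE strE) (listE strE)) bitE (fun p => decide (p.2.length = 0)) :=
    (CodeFP.eq unE_injective).comp (((ulength strE).comp pas).pair (const _ 0))
  -- the EXIT / ENTRANCE branch: encrypt the root label of the side given by the first request bit
  have hAB : CodeFP (pairE (pairE unE strE) (listE strE)) strE (fun p =>
      if p.2.length = 0 then false :: false :: mkLabel (Λ.depth p.1.1) (p.1.2.getD 0 false) 0 0 else []) :=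
    (t₀.ite (consBit.comp ((const _ false).pair (consBit.comp ((const _ false).pair
      (wq_mkLabel hd hb₀ (const _ (0 : ℕ)) (const _ (0 : ℕ))))))) (const _ ([] : List Bool))).congr
      fun p => by simp only [decide_eq_true_eq]
  have hC := wq_bodyC hμ hd (strDrop.comp ((const _ 2).pair pr)) pas
  exact (((hμ.pair hd).pair ((hb₀.or hb₁).ite hAB hC)).recodeOut (eγ := strE)
    (g' := fun p : (ℕ × List Bool) × List (List Bool) => walkQ Λ p.1 p.2) fun p => by
      rw [wq_walkQ_eq]; rfl)

end Summit.QuantumAdvantage.QuantumAdvantage.Theorems.WbwObfuscatedGluedTrees.KnowledgeOfWalk.PrfHybrid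

end
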